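import Literature.Probability.MarkovChains.GreenTreeFormula
import Literature.Probability.MarkovChains.MarkovChainTreeTheorem
import HarnessLib

/-!
# Mean first passage times and Kemeny's constant of a finite Markov chain as forest sums
# (Pitman–Tang Thm. 1.3, eq. (1.1), Cor. 1.4)

HONEST FRAMING (as everywhere in this directory): finite state space, no path space — the mean
hitting times `m_{ij} = E_i T_j` are the solution `h i j` of the tree's first-step system
`IsHittingTimeSolution P h` (unique on an irreducible chain), with the tree's convention `h j j = 0`;
Pitman–Tang's `m_{jj}` is the mean RETURN time `E_j T_j⁺ = 1 + Σ_y p_{jy} h_{yj}`, and Kemeny's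
constant is the tree's target time `t⊙ = Σ_j m_{ij} π_j` (`targetTime π h i`), so that the paper's
`K = Σ_j m_{ij}/m_{jj} = 1 + t⊙` (the term `j = i` contributes `m_{ii}/m_{ii} = 1`).

Lane `lit-hodgefound`, seat p23, generation 47, row g47-#3 of the programme «Tree and forest formulas
for finite Markov chains» [PitmanTang2018] (rows #1 `Combinatorics/Enumerative/MatrixForestTheoremInverse`,
#2 `Probability/MarkovChains/GreenTreeFormula`).

## Source, verbatim ([PitmanTang2018], held text `paper:arxiv-1603.09017`, §1 pp. 3–5, §3 pp. 8–9)

«It is well-known that the irreducible chain has a unique stationary distribution `(π_j)_{j ∈ S}`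
which is given by `π_j = 1/m_{jj}` for all `j ∈ S`. […] Write `t → j` to indicate that the edges of
a tree **t** are all directed towards a root element `j ∈ t`. The formula
`m_{jj} = 1/π_j = Σ^{(1)} / Σ_j` (1.1), where `Σ_j := Σ_{t → j} Π^P(t)` and `Σ^{(1)} := Σ_{j ∈ S} Σ_j`
(1.2) follows readily from the Markov chain tree theorem.»
**Theorem 1.3** (Markov chain tree formula for mean first passage times). «Let **P** be a transition
matrix for an irreducible chain. For each `i ≠ j`, `m_{ij} = Σ_{ij} / Σ_j` (1.11), where
`Σ_{ij} := Σ_{t → j} Π^P(t) / p_{k(i,j,t) j}` (1.12) with `k(i,j,t)` the last state before `j` in the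
path from `i` to `j` in **t**.» §3, proof: «By setting `R = {j}` in the formula (1.8), we get
`m_{ij} = Σ_{k ≠ j} w_{ik}({j,k}) / w({j})` […] the formula (1.12) for `Σ_{ij}` can be rewritten as
`Σ_{ij} = Σ_{i ∈ s, u → j} Π^P(s, u)` (3.4)», the sum over «two tree forests `(s, u)` such that `i ∈ s`
and `u → j`». «To illustrate, for `|S| = 2` states `{0, 1}`, `m_{10} = 1/p_{10}`.»
**Corollary 1.4** (Combinatorial interpretation of Kemeny's constant). «For `r ∈ ℕ`, let
`Σ^{(r)} := Σ_{t_1, …, t_r} Π^P(t_1, …, t_r)`, where the sum is over all directed forests of `r` trees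
labeled by `S`. Then `K = 1 + Σ^{(2)} / Σ^{(1)}` (1.14)», where (eq. (1.13)) «`K := Σ_{j ∈ S} m_{ij}/m_{jj}`
is a constant, not depending on `i` […] known as Kemeny's constant.»

## What is here (`P : Matrix X X ℝ` irreducible row-stochastic; `p x y = P x y` its weights)

* §0 the bridge to the tree's Markov chain tree theorem file: `treeMeasure P r = w({r})`
  (`treeMeasure_eq_forestWeight`), so `Σ_j` = `treeMeasure P j`, `Σ^{(1)} = Σ_j treeMeasure P j`, and
  Theorem 1.1 in the forest vocabulary (`PitmanTang2018_thm_1_1`, the tree's theorem restated — PROVED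
  there, not here).

* `passageForestSum P i j = Σ_{ij}` in the two-forest form (3.4): `Σ_{k ≠ j} w_{ik}({k, j})` — the total
  weight of the two-tree forests `(s, u)` with `i ∈ s` and `u → j` (root of `s` = `k`); `forestSumCard
  P r = Σ^{(r)} = Σ_{|R| = r} w(R)`; `forestSumCard_one` (`Σ^{(1)} = Σ_j Σ_j`, `Σ_j` = the tree's
  `treeMeasure P j` by row #2).
* **Theorem 1.3** `IsHittingTimeSolution.PitmanTang2018_thm_1_3` — **`m_{ij} = Σ_{ij} / Σ_j`** (`i ≠ j`),
  from (1.8) of row #2; the degenerate diagonal reading `h_{jj} Σ_j = Σ_{jj} = 0` (`passageForestSum_self`).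
* **eq. (1.1)** `IsHittingTimeSolution.PitmanTang2018_eq_1_1` — **`m_{jj} = E_j T_j⁺ = Σ^{(1)} / Σ_j`**
  (Kac's return-time identity of the tree with the Markov chain tree theorem).
* **Corollary 1.4** `PitmanTang2018_cor_1_4` — **`t⊙ = Σ_j π_j m_{ij} = Σ^{(2)} / Σ^{(1)}`**, i.e.
  `K = 1 + Σ^{(2)}/Σ^{(1)}`, via the double count `Σ_j Σ_{ij} = Σ^{(2)}` (`sum_passageForestSum`: a
  two-tree forest is counted once, for `j` the root of the tree not containing `i`).
* the printed two-state instance `m_{10} = 1/p_{10}` (`PitmanTang2018_twoState`).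

* the printed form (1.12) of `Σ_{ij}` — trees `t → j` cut at the last arc `k(i,j,t) → j` before `j`
  (`passageForestSum_eq_sum_trees`, the bijection `t ↦ (s, u)` of §3, division-free).

NOT CLAIMED here: Theorem 3.1 (reducible chains), §4.1 (the spectral form of `Σ^{(1)}`).

## References

* [PitmanTang2018] §1 eqs. (1.1)–(1.2), Thm. 1.3 (eqs. (1.11)–(1.12)), eq. (1.13), Cor. 1.4
  (eq. (1.14)); §3 (proof of Thm. 1.3, eq. (3.4)).
* [LevinPeres2017] §10.2 Lemma 10.1 (Random Target Lemma; tree `RandomTargetLemma`: `targetTime`,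
  `IsHittingTimeSolution`, `returnTime_identity`).
* [LyonsPeres2016] §4.4 (tree `MarkovChainTreeTheorem`).
-/

namespace Literature.Probability.MarkovChains

open Finset Matrix Function Literature.Combinatorics.Enumerative

variable {X : Type*} [Fintype X] [DecidableEq X]

/-! ### §0 The bridge to the Markov chain tree theorem file: `treeMeasure P r = w({r})` -/

section Bridge

omit [DecidableEq X] in
/-- The tree's spanning arborescences rooted at `r` (`IsSpanningArb`, parent maps under which every
vertex reaches `r`) are the forests with root set `{r}`. [cite: PitmanTang2018, §1 eq. (1.2)
(`Σ_j := Σ_{t → j} Π^P(t)`: trees as one-root forests)] [cite: LyonsPeres2016, §4.4] -/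
theorem isSpanningArb_iff_isForestOn [DecidableEq X] {g : X → X} {r : X} :
    IsSpanningArb g r ↔ IsForestOn (univ : Finset X) {r} g := by
  rw [isForestOn_univ_iff]
  simp only [mem_singleton, forall_eq]
  rfl

/-- **`Σ_r = w({r})`**: the tree measure of the Markov chain tree theorem file is the one-root forest
weight of row #1. [cite: PitmanTang2018, §1 eq. (1.2)] [cite: LyonsPeres2016, §4.4
(`Σ_{root(T) = x} Ψ(T)`)] -/
theorem treeMeasure_eq_forestWeight (P : X → X → ℝ) (r : X) :
    treeMeasure P r = forestWeight P {r} := by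
  classical
  rw [treeMeasure, forestWeight, ← sum_filter]
  refine sum_congr ?_ fun g _ => ?_
  · ext g
    simp only [mem_filter, mem_univ, true_and, mem_forests, isSpanningArb_iff_isForestOn]
  · rw [arbWeight, compl_singleton]

/-- **The Markov chain tree theorem (Theorem 1.1) in the forest vocabulary**: `Σ_i w({i}) p_{ij} =
w({j})` — the tree's `LyonsPeres2016_markovChainTree` ∕ `treeMeasure_isStationary`, restated.
[cite: PitmanTang2018, Thm. 1.1 eq. (1.3)] [cite: LyonsPeres2016, §4.4] -/
theorem PitmanTang2018_thm_1_1 (P : X → X → ℝ) (hP : ∀ x, ∑ y, P x y = 1) (j : X) :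
    ∑ i, forestWeight P {i} * P i j = forestWeight P {j} := by
  simp_rw [← treeMeasure_eq_forestWeight]
  exact treeMeasure_isStationary P hP j

end Bridge

/-! ### §1 `Σ_{ij}` and `Σ^{(r)}` -/

section Defs

/-- **`Σ_{ij} = Σ_{i ∈ s, u → j} Π^P(s, u)`**, the total weight of the two-tree forests `(s, u)` with
`i` in the tree `s` and `j` the root of the other tree `u`, arranged by the root `k ≠ j` of `s`:
`Σ_{k ≠ j} w_{ik}({k, j})`. [cite: PitmanTang2018, §3 eq. (3.4); Thm. 1.3 eq. (1.12)] -/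
noncomputable def passageForestSum (P : X → X → ℝ) (i j : X) : ℝ :=
  ∑ k ∈ univ.erase j, forestWeightTo P {k, j} i k

/-- **`Σ^{(r)} = Σ_{t_1, …, t_r} Π^P(t_1, …, t_r)`**, the total weight of the forests of `r` trees, i.e.
`Σ_{|R| = r} w(R)` over the root sets. [cite: PitmanTang2018, Cor. 1.4 (definition of `Σ^{(r)}`)] -/
noncomputable def forestSumCard (P : X → X → ℝ) (r : ℕ) : ℝ :=
  ∑ R ∈ (univ : Finset X).powersetCard r, forestWeight P R

variable (P : X → X → ℝ)

/-- [cite: PitmanTang2018, §3 eq. (3.4)] -/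
theorem passageForestSum_def (i j : X) :
    passageForestSum P i j = ∑ k ∈ univ.erase j, forestWeightTo P {k, j} i k := rfl

/-- [cite: PitmanTang2018, Cor. 1.4] -/
theorem forestSumCard_def (r : ℕ) :
    forestSumCard P r = ∑ R ∈ (univ : Finset X).powersetCard r, forestWeight P R := rfl

/-- `Σ^{(1)} = Σ_j w({j}) = Σ_j Σ_j`. [cite: PitmanTang2018, §1 eq. (1.2) (`Σ^{(1)} := Σ_{j ∈ S} Σ_j`)] -/
theorem forestSumCard_one : forestSumCard P 1 = ∑ j, treeMeasure P j := by
  rw [forestSumCard, powersetCard_one, sum_map]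
  exact sum_congr rfl fun j _ => (treeMeasure_eq_forestWeight P j).symm

/-- `Σ_{jj} = 0` (no two-tree forest has `j` in the tree not containing `j`) — consistent with the
tree's convention `h j j = 0`. [cite: PitmanTang2018, §3 eq. (3.4) (`i ∈ s`, `u → j`)] -/
theorem passageForestSum_self (j : X) : passageForestSum P j j = 0 := by
  rw [passageForestSum]
  refine sum_eq_zero fun k hk => ?_
  rw [forestWeightTo_of_mem_roots P _ (mem_insert_of_mem (mem_singleton_self j)),
    if_neg (ne_of_mem_erase hk)]

/-- For a non-negative kernel `Σ_{ij} ≥ 0`. [cite: PitmanTang2018, Thm. 1.3] -/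
theorem passageForestSum_nonneg {P : Matrix X X ℝ} (hP : ∀ x y, 0 ≤ P x y) (i j : X) :
    0 ≤ passageForestSum (fun x y => P x y) i j :=
  sum_nonneg fun _ _ => forestWeightTo_nonneg hP _ _ _

/-- Pairs `(R, k)` with `|R| = 2`, `k ∈ R` are the ordered pairs `(j, k)`, `k ≠ j`, `R = {k, j}`.
[cite: PitmanTang2018, Cor. 1.4 (proof: the two-tree forests of (3.4) arranged by root sets)] -/
theorem sum_powersetCard_two_sum {M : Type*} [AddCommMonoid M] (F : Finset X → X → M) :
    ∑ R ∈ (univ : Finset X).powersetCard 2, ∑ k ∈ R, F R k = ∑ j, ∑ k ∈ univ.erase j, F {k, j} k := by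
  have hT : ∀ q : Finset X × X, q ∈ ((univ : Finset X).powersetCard 2 ×ˢ univ).filter (fun q => q.2 ∈ q.1)
      ↔ q.1 ∈ (univ : Finset X).powersetCard 2 ∧ q.2 ∈ (fun R : Finset X => R) q.1 := by
    intro q
    simp only [mem_filter, mem_product, mem_univ, and_true]
  have hO : ∀ q : X × X, q ∈ (univ : Finset X).offDiag ↔ q.1 ∈ (univ : Finset X) ∧ q.2 ∈ univ.erase q.1 := by
    intro q
    simp only [mem_offDiag, mem_univ, true_and, mem_erase, and_true, ne_comm]
  rw [← sum_finset_product' (f := F) _ _ _ hT, ← sum_finset_product' (f := fun j k => F {k, j} k) _ _ _ hO]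
  symm
  refine sum_bij (fun q _ => ({q.2, q.1}, q.2)) ?_ ?_ ?_ ?_
  · rintro ⟨j, k⟩ hq
    rw [mem_offDiag] at hq
    simp only [mem_filter, mem_product, mem_univ, and_true, mem_powersetCard, subset_univ, true_and,
      mem_insert_self]
    exact card_pair (Ne.symm hq.2.2)
  · rintro ⟨j, k⟩ hq ⟨j', k'⟩ hq' heq
    rw [mem_offDiag] at hq hq'
    simp only [Prod.mk.injEq] at heq ⊢
    obtain ⟨hR, rfl⟩ := heq
    refine ⟨?_, rfl⟩
    have hj : j ∈ ({k, j'} : Finset X) := hR ▸ mem_insert_of_mem (mem_singleton_self j)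
    rcases mem_insert.1 hj with h | h
    · exact absurd h hq.2.2
    · exact mem_singleton.1 h
  · rintro ⟨R, k⟩ hb
    simp only [mem_filter, mem_product, mem_univ, and_true, mem_powersetCard, subset_univ, true_and] at hb
    obtain ⟨hcard, hk⟩ := hb
    obtain ⟨x, y, hxy, rfl⟩ := card_eq_two.1 hcard
    rcases mem_insert.1 hk with rfl | hk
    · exact ⟨(y, k), by simp [mem_offDiag, hxy.symm], rfl⟩
    · obtain rfl := mem_singleton.1 hk
      refine ⟨(x, k), by simp [mem_offDiag, hxy], ?_⟩
      show (({k, x} : Finset X), k) = ({x, k}, k)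
      rw [pair_comm]
  · rintro ⟨j, k⟩ _
    rfl

/-- **The double count behind Corollary 1.4**: `Σ_j Σ_{ij} = Σ^{(2)}` — summing the two-forest sums
over the root `j` of the tree avoiding `i` counts every two-tree forest exactly once (by the root of
the tree NOT containing `i`; the root of the tree containing `i` gives `w_{ik}(R)`, and
`Σ_{k ∈ R} w_{ik}(R) = w(R)`). [cite: PitmanTang2018, Cor. 1.4 (proof: «a corollary of the formula
(3.4)»)] -/
theorem sum_passageForestSum (i : X) : ∑ j, passageForestSum P i j = forestSumCard P 2 := by
  rw [forestSumCard, sum_congr rfl fun R _ => (sum_forestWeightTo P R i).symm,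
    sum_powersetCard_two_sum]
  rfl

end Defs

/-! ### §2 Theorem 1.3 and eq. (1.1) -/

section Passage

variable {P : Matrix X X ℝ} {h : X → X → ℝ}

/-- **Theorem 1.3 (Markov chain tree formula for mean first passage times)**: on an irreducible chain,
for `i ≠ j` the mean first passage time — the tree's solution `h i j = E_i T_j` of the first-step
equations — is **`m_{ij} = Σ_{ij} / Σ_j`**, `Σ_{ij}` in the two-forest form (3.4) and `Σ_j` the tree
sum (`treeMeasure`). (For `i = j` the identity degenerates to `0 = 0`: the tree's `h j j = E_j T_j = 0`
and `Σ_{jj} = 0`; the paper's `m_{jj} = E_j T_j⁺` is eq. (1.1) below.) [cite: PitmanTang2018, Thm. 1.3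
eq. (1.11), with `Σ_{ij}` as in §3 eq. (3.4)] -/
theorem IsHittingTimeSolution.PitmanTang2018_thm_1_3 (hP : IsRowStochastic P) (hirr : IsIrreducible P)
    (hh : IsHittingTimeSolution P h) (i j : X) :
    h i j = passageForestSum (fun x y => P x y) i j / treeMeasure P j := by
  rw [passageForestSum, treeMeasure_eq_forestWeight]
  exact hh.PitmanTang2018_eq_1_8 hP hirr i j

/-- Theorem 1.3 cleared of the denominator, valid on the diagonal too: `m_{ij} Σ_j = Σ_{ij}`.
[cite: PitmanTang2018, Thm. 1.3 eq. (1.11)] -/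
theorem IsHittingTimeSolution.mul_treeMeasure_eq_passageForestSum (hP : IsRowStochastic P)
    (hirr : IsIrreducible P) (hh : IsHittingTimeSolution P h) (i j : X) :
    h i j * treeMeasure P j = passageForestSum (fun x y => P x y) i j := by
  rw [hh.PitmanTang2018_thm_1_3 hP hirr, div_mul_cancel₀ _ (treeMeasure_pos hP hirr j).ne']

/-- The normalised tree measure is a stationary distribution. [cite: PitmanTang2018, Thm. 1.1
(«the unique stationary distribution for the chain is `π_j = Σ_j/Σ^{(1)}`»)] [cite: LyonsPeres2016,
§4.4] -/
theorem isStationary_treeMeasure_div (hP : IsRowStochastic P) :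
    IsStationary (fun x => treeMeasure P x / ∑ k, treeMeasure P k) P := by
  intro y
  simp_rw [div_mul_eq_mul_div, ← sum_div]
  rw [treeMeasure_isStationary P hP.2 y]

/-- **eq. (1.1)**: the mean return time is `m_{jj} = E_j T_j⁺ = 1 + Σ_y p_{jy} m_{yj} = 1/π_j = Σ^{(1)}/Σ_j`
(Kac's identity of the tree with the Markov chain tree theorem). [cite: PitmanTang2018, §1 eq. (1.1)]
[cite: LevinPeres2017, §1.5.4 Prop. 1.19 (`E_a(τ_a⁺) = 1/π(a)`)] -/
theorem IsHittingTimeSolution.PitmanTang2018_eq_1_1 (hP : IsRowStochastic P) (hirr : IsIrreducible P)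
    (hh : IsHittingTimeSolution P h) (j : X) :
    1 + ∑ y, P j y * h y j = (∑ k, treeMeasure P k) / treeMeasure P j := by
  haveI : Nonempty X := ⟨j⟩
  have hZ : 0 < ∑ k, treeMeasure P k := sum_pos (fun k _ => treeMeasure_pos hP hirr k) univ_nonempty
  have hj : 0 < treeMeasure P j := treeMeasure_pos hP hirr j
  have hπ1 : ∑ x, treeMeasure P x / ∑ k, treeMeasure P k = 1 := by
    rw [← sum_div, div_self hZ.ne']
  have key := hh.returnTime_identity (isStationary_treeMeasure_div hP) hπ1 j
  rw [eq_div_iff hj.ne']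
  have : treeMeasure P j = (treeMeasure P j / ∑ k, treeMeasure P k) * ∑ k, treeMeasure P k := by
    rw [div_mul_cancel₀ _ hZ.ne']
  rw [this, ← mul_assoc, mul_comm (1 + _), key, one_mul]

end Passage

/-! ### §3 Corollary 1.4: Kemeny's constant -/

section Kemeny

variable {P : Matrix X X ℝ} {h : X → X → ℝ} {π : X → ℝ}

/-- **Corollary 1.4 (combinatorial interpretation of Kemeny's constant)**: on an irreducible chain with
stationary distribution `π`, the target time `t⊙ = Σ_j m_{ij} π_j` of the tree (`targetTime`, the Random
Target Lemma's constant) is **`Σ^{(2)} / Σ^{(1)}`**, the total weight of the two-tree forests over that of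
the spanning trees — i.e. Kemeny's constant of the paper, `K = Σ_j m_{ij}/m_{jj} = 1 + t⊙`, is
`K = 1 + Σ^{(2)}/Σ^{(1)}`. [cite: PitmanTang2018, Cor. 1.4 eq. (1.14); eq. (1.13)]
[cite: LevinPeres2017, §10.2 Lemma 10.1 (the target time)] -/
theorem PitmanTang2018_cor_1_4 (hP : IsRowStochastic P) (hirr : IsIrreducible P)
    (hπ : IsStationary π P) (hπ1 : ∑ x, π x = 1) (hh : IsHittingTimeSolution P h) (i : X) :
    targetTime π h i = forestSumCard (fun x y => P x y) 2 / forestSumCard (fun x y => P x y) 1 := by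
  haveI : Nonempty X := ⟨i⟩
  rw [LyonsPeres2016_markovChainTree_eq hP hirr hπ hπ1, targetTime_def, forestSumCard_one,
    ← sum_passageForestSum _ i]
  simp_rw [mul_div_assoc', ← sum_div]
  congr 1
  refine sum_congr rfl fun x _ => ?_
  exact hh.mul_treeMeasure_eq_passageForestSum hP hirr i x

/-- Corollary 1.4 in the paper's normalisation: `K = 1 + t⊙ = 1 + Σ^{(2)}/Σ^{(1)}`.
[cite: PitmanTang2018, Cor. 1.4 eq. (1.14)] -/
theorem PitmanTang2018_eq_1_14 (hP : IsRowStochastic P) (hirr : IsIrreducible P)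
    (hπ : IsStationary π P) (hπ1 : ∑ x, π x = 1) (hh : IsHittingTimeSolution P h) (i : X) :
    1 + targetTime π h i =
      1 + forestSumCard (fun x y => P x y) 2 / forestSumCard (fun x y => P x y) 1 := by
  rw [PitmanTang2018_cor_1_4 hP hirr hπ hπ1 hh i]

end Kemeny

/-! ### §4 The two-state chain -/

section TwoState

variable {P : Matrix (Fin 2) (Fin 2) ℝ} {h : Fin 2 → Fin 2 → ℝ}

/-- `Σ_0 = p_{10}` for two states (the one tree `1 → 0`), by Lemma 2.2: `1 = w({0,1}) = w({0}) + p_{11}`.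
[cite: PitmanTang2018, §1 («for `|S| = 2` states `{0, 1}`, `m_{10} = 1/p_{10}`»)] -/
theorem treeMeasure_twoState_zero (hP : ∀ x, ∑ y, P x y = 1) : treeMeasure P 0 = P 1 0 := by
  have h01 : (1 : Fin 2) ∉ ({0} : Finset (Fin 2)) := by decide
  have huniv : insert (1 : Fin 2) ({0} : Finset (Fin 2)) = univ := by decide
  have hc : ({0} : Finset (Fin 2))ᶜ = {1} := by decide
  have key := forestWeight_insert_of_rowsum (fun x y => P x y) h01 (hP 1)
  rw [hc, sum_singleton, forestWeightTo_self, huniv, forestWeight_univ, mul_one] at key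
  have hrow := hP 1
  rw [Fin.sum_univ_two] at hrow
  rw [treeMeasure_eq_forestWeight]
  linarith

/-- `Σ_{10} = 1` for two states (the two-tree forest with no arc). [cite: PitmanTang2018, §1
(«for `|S| = 2` states `{0, 1}`, `m_{10} = 1/p_{10}`»)] -/
theorem passageForestSum_twoState (P : Fin 2 → Fin 2 → ℝ) : passageForestSum P 1 0 = 1 := by
  have he : (univ : Finset (Fin 2)).erase 0 = {1} := by decide
  have huniv : ({1, 0} : Finset (Fin 2)) = univ := by decide
  rw [passageForestSum, he, sum_singleton, forestWeightTo_self, huniv, forestWeight_univ]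

/-- **The printed two-state instance of Theorem 1.3: `m_{10} = 1/p_{10}`.** [cite: PitmanTang2018, §1
(«To illustrate, for `|S| = 2` states `{0,1}`, `m_{10} = 1/p_{10}`»)] -/
theorem PitmanTang2018_twoState (hP : IsRowStochastic P) (hirr : IsIrreducible P)
    (hh : IsHittingTimeSolution P h) : h 1 0 = 1 / P 1 0 := by
  rw [hh.PitmanTang2018_thm_1_3 hP hirr, passageForestSum_twoState, treeMeasure_twoState_zero hP.2]

end TwoState

/-! ### §5 The printed form (1.12) of `Σ_{ij}`: trees cut at the last arc before `j` -/

section LastArc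

variable (P : X → X → ℝ)

open Classical in
/-- **`Σ_{ij}` as printed, eq. (1.12)**: `Σ_{ij} = Σ_{t → j} Π^P(t) / p_{k(i,j,t) j}` with `k(i,j,t)` the
last state before `j` on the path from `i` to `j` in the tree **t** — here division-free and arranged by
that state `k`: the trees `t → j` with `i ⤳ k` and arc `k → j`, weighted by the product of their arc
weights OTHER than `p_{kj}`, give exactly the two-forest sum (3.4) («the map `t ↦ (s, u)` is a bijection
between trees `t → j` and two tree forests `(s, u)` such that `i ∈ s` and `u → j`»: cut the arc
`k → j`; inverse: re-attach it). [cite: PitmanTang2018, Thm. 1.3 eq. (1.12); §3, proof of Thm. 1.3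
(the bijection `t ↦ (s, u)`, eq. (3.4))] -/
theorem passageForestSum_eq_sum_trees (i j : X) :
    passageForestSum P i j = ∑ k ∈ univ.erase j,
      ∑ t ∈ (forests (univ : Finset X) {j}).filter (fun t => Leads t i k ∧ t k = j),
        ∏ v ∈ ({k, j} : Finset X)ᶜ, P v (t v) := by
  classical
  rw [passageForestSum]
  refine sum_congr rfl fun k hk => ?_
  have hkj : k ≠ j := ne_of_mem_erase hk
  have hkj' : k ∉ ({j} : Finset X) := fun h => hkj (mem_singleton.1 h)
  rw [forestWeightTo_def]
  -- cut the arc `k → j` / re-attach it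
  refine sum_nbij' (fun τ => update τ k j) (fun t => update t k k) ?_ ?_ ?_ ?_ ?_
  · intro τ hτ
    simp only [mem_filter, mem_forests] at hτ ⊢
    obtain ⟨hτ, hik⟩ := hτ
    have hjk : ¬ Leads τ j k := fun h =>
      hkj ((hτ.leads_root_iff (mem_insert_of_mem (mem_singleton_self j))).1 h)
    have h := hτ.update_erase hjk
    rw [erase_insert hkj'] at h
    exact ⟨h, leads_update_of_leads hik, update_self _ _ _⟩
  · intro t ht
    simp only [mem_filter, mem_forests] at ht ⊢
    obtain ⟨ht, hik, -⟩ := ht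
    exact ⟨ht.update_self_insert k, leads_update_of_leads hik⟩
  · intro τ hτ
    simp only [mem_filter, mem_forests] at hτ
    rw [update_idem]
    exact update_eq_iff.2 ⟨(hτ.1.apply_of_mem_roots (mem_insert_self k {j})).symm, fun _ _ => rfl⟩
  · intro t ht
    simp only [mem_filter, mem_forests] at ht
    rw [update_idem]
    exact update_eq_iff.2 ⟨ht.2.2.symm, fun _ _ => rfl⟩
  · intro τ _
    refine prod_congr rfl fun v hv => ?_
    rw [update_of_ne fun h : v = k => (mem_compl.1 hv) (h ▸ mem_insert_self k {j})]

end LastArc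

end Literature.Probability.MarkovChains
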